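import Summits.BirchSwinnertonDyer.BirchSwinnertonDyer.Theorems.PrintX8VSInputHondaSystemLocalRelations
import Summits.BirchSwinnertonDyer.BirchSwinnertonDyer.Theorems.PrintX8VSInputHondaSystemLocalGeneration
import Summits.BirchSwinnertonDyer.BirchSwinnertonDyer.Theorems.PrintX8VSInputHondaSystemPadicModel
import Summits.BirchSwinnertonDyer.BirchSwinnertonDyer.Theorems.PrintX8VSInputHondaSystemSprungLog
import Summits.BirchSwinnertonDyer.Rank1Residual.Additive.KobayashiSignedGenerationRat
import Literature.NumberTheory.NumberFields.CyclotomicMaximalRealSubfieldDegree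
import HarnessLib

/-!
# The primal Honda data of Sprung's Theorem 2.2 over Mathlib's `ℚ_[p]`, for every embedding `ι : ℚ̄ → ℚ̄_p` (route `PrintX8VS` /
# `PrintX8`, support item `InputHondaSystem` = stmt-BirchSwinnertonDyer-20413, named fact `Sprung2012.thm22_exists_isHondaSystem`;
# file 17 of the local series: ASSEMBLY of files 1–16 at `ℚ_p`)

HONEST FRAMING (desk `pub/bsd-wall/bsd-inputs`, seat `bsd-inputs-honda-p1`, D-0154 (2) INPUTS): THEOREMS ONLY — no definition, no
named fact, no instance, no `sorry`; closes nothing by itself; BSD is not proved by any of this.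

## What

For `W/ℚ` globally minimal with good reduction at the odd prime `p` and `p ∣ a_p` (`a_p = W.frobeniusTrace p`; supersingular), a
cyclotomic `κ` and ANY `ι`: points `c_{−1} ∈ E(ℚ_p)`, `c_n ∈ E(ℚ_{p,n}·ℚ_p)` (Kobayashi's layers through `ι`) and an integer `N` prime
to `p` with the three trace relations of `Sprung2012.IsHondaSystem` and generation in `ℤ[Γ]`-form
(`N·E(ℚ_{p,n}) ⊆ ℤ[Γ·c_n] + E(ℚ_{p,n−1}) + p·E(ℚ_{p,n})`, `N·E(ℚ_p) ⊆ ℤ·c_{−1} + p·E(ℚ_p)`). Construction: the `p`-adic model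
(file `…PadicModel`), the Sprung sequence and logarithm (files `…SprungLog*`), the integral Honda isomorphism (`…SprungHondaIso`), the
tower points over `ℚ_p(ζ_{p^m})` (`…SprungTowerPoints/Generation/Relations`), and the rescaled `Δ`-descent to the `ℤ_p`-layers
(`…LocalTraces/Relations/Generation`) along Kobayashi's tower `towerSubgroup κ ℚ(ζ_p)`.

References: [Sprung2012] F. Sprung, J. Number Theory 132 (2012), Thm. 2.2 (p. 1487), Cor. 2.10, Lemmas 7.4–7.5; [Kobayashi2003]
S. Kobayashi, Invent. Math. 152 (2003), §8 (Lemma 8.9, Prop. 8.11, Prop. 8.12).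
-/

set_option autoImplicit false
-- the Theorems namespace of this sub repeats the summit name by design (D-0017 nested layout)
set_option linter.dupNamespace false

noncomputable section

open scoped Classical
open Finset PowerSeries

namespace Summit.BirchSwinnertonDyer.BirchSwinnertonDyer.Theorems

namespace SprungHonda

open Literature.NumberTheory.EllipticCurves Literature.NumberTheory.GaloisRepresentations
  Literature.NumberTheory.EllipticCurves.ZpExtension Literature.NumberTheory.EllipticCurves.Kobayashi2003
  Summit.BirchSwinnertonDyer.Rank1Residual.Additive Summit.BirchSwinnertonDyer.Rank1Residual.Additive.PadicCyclotomicTower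
  Summit.BirchSwinnertonDyer.Rank1Residual.Additive.BallEval
open Literature.NumberTheory.EllipticCurves.FormalGroupChart (kernel)
open Literature.RingTheory.FormalGroups (hondaShift)

variable {p : ℕ} [hp : Fact p.Prime]

/-- **The primal Honda data of Sprung's Thm. 2.2 over `ℚ_[p]`, for every embedding `ι`.**
[cite: Sprung2012, Thm. 2.2 (p. 1487) and Cor. 2.10 (p. 1489)] [cite: Kobayashi2003, Prop. 8.12 and Lemma 8.9] -/
theorem exists_primalHonda_padic (W : WeierstrassCurve ℚ) [W.IsElliptic] [W.IsGloballyMinimal] (hp2 : p ≠ 2)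
    (hgood : W.HasGoodReductionAtPrime p) (hap : (p : ℤ) ∣ W.frobeniusTrace p) (κ : ZpExtension ℚ p) (hκ : κ.IsCyclotomic)
    (ι : AlgebraicClosure ℚ →ₐ[ℚ] AlgebraicClosure ℚ_[p]) :
    ∃ (cneg : localPoints W ℚ_[p]) (c : ℕ → localPoints W ℚ_[p]) (N : ℕ), N.Coprime p ∧
      cneg ∈ localLayerPointsOfEmb κ ι W 0 ∧ (∀ n, c n ∈ localLayerPointsOfEmb κ ι W n) ∧
      c 0 = (W.frobeniusTrace p - 2) • cneg ∧
      localTraceOfEmb κ ι W 0 1 (c 1) = W.frobeniusTrace p • c 0 - ((p : ℤ) - 1) • cneg ∧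
      (∀ n : ℕ, 1 ≤ n → localTraceOfEmb κ ι W n (n + 1) (c (n + 1)) = W.frobeniusTrace p • c n - c (n - 1)) ∧
      (∀ m : ℕ, 1 ≤ m → ∀ P ∈ localLayerPointsOfEmb κ ι W m,
        ∃ B ∈ AddSubgroup.closure (Set.range fun σ : Field.absoluteGaloisGroup ℚ_[p] ↦ σ • c m),
          ∃ P' ∈ localLayerPointsOfEmb κ ι W (m - 1), ∃ R ∈ localLayerPointsOfEmb κ ι W m, N • P = B + P' + p • R) ∧
      (∀ P ∈ localLayerPointsOfEmb κ ι W 0, ∃ u : ℤ, ∃ R ∈ localLayerPointsOfEmb κ ι W 0, N • P = u • cneg + p • R) := by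
  set a : ℤ := W.frobeniusTrace p with ha_def
  -- the `p`-adic model
  obtain ⟨M, hE, hEt, htr, hΔ, hA, hWM⟩ := exists_padicModel_of_dvd_frobeniusTrace hp2 W hgood hap
  haveI := hE
  haveI := hEt
  haveI hintΩ : (genFibΩ p M).IsIntegral (Valued.v (R := PadicAlgCl p)).integer := isIntegral_genFib_baseChange p M
  have hV : genFibΩ p M = W.baseChange (AlgebraicClosure ℚ_[p]) := (genFibΩ_eq_baseChange M).trans hWM
  -- Kobayashi's tower through `F = ℚ(ζ_p)`
  haveI : NeZero p := ⟨hp.out.ne_zero⟩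
  haveI := Literature.NumberTheory.NumberFields.isCyclotomicExtension_cyclotomicField_rat p
  haveI := normal_galRange_cyclotomic p (CyclotomicField p ℚ)
  let U : ℕ → Subgroup (Field.absoluteGaloisGroup ℚ) := towerSubgroup κ (CyclotomicField p ℚ)
  haveI hUf : ∀ n, (U n).FiniteIndex := fun n ↦ inferInstanceAs (towerSubgroup κ (CyclotomicField p ℚ) n).FiniteIndex
  haveI hUN : ∀ n, (U n).Normal := fun n ↦ inferInstanceAs (towerSubgroup κ (CyclotomicField p ℚ) n).Normal
  have hU : ∀ n, localSubgroupOfEmb (U n) ι = stab p (n + 1) := fun n ↦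
    localSubgroupOfEmb_towerSubgroup_eq_stab_rat (F := CyclotomicField p ℚ) (ι := ι) κ hp2 hκ n
  have hUL : ∀ n, U n ≤ κ.layerSubgroup n := fun n ↦ inf_le_left
  have hUa : Antitone U := towerSubgroup_antitone κ (CyclotomicField p ℚ)
  -- the Sprung sequence `x 0 = 1`, `p x 1 = a`, `p x (k+2) = a x (k+1) − x k`
  have hpq : (p : ℚ_[p]) ≠ 0 := by exact_mod_cast hp.out.ne_zero
  let xs : ℕ → ℚ_[p] × ℚ_[p] := fun k ↦
    Nat.rec ((1 : ℚ_[p]), ((a : ℚ_[p]) / p)) (fun _ q ↦ (q.2, ((a : ℚ_[p]) * q.2 - q.1) / p)) k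
  let x : ℕ → ℚ_[p] := fun k ↦ (xs k).1
  have hx0 : x 0 = 1 := rfl
  have hx1 : (p : ℚ_[p]) * x 1 = a := by
    show (p : ℚ_[p]) * ((a : ℚ_[p]) / p) = a
    field_simp
  have hrec : ∀ k, (p : ℚ_[p]) * x (k + 2) = a * x (k + 1) - x k := by
    intro k
    show (p : ℚ_[p]) * (((a : ℚ_[p]) * (xs k).2 - (xs k).1) / p) = a * (xs k).2 - (xs k).1
    field_simp
  have ha : ‖((a : ℤ) : ℚ_[p])‖ ≤ (p : ℝ)⁻¹ := norm_intCast_le_inv_of_dvd hap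
  have hxb : ∀ k, ‖x k‖ ≤ Real.sqrt p ^ k := norm_sprungSeq_le ha hx0 hx1 hrec
  -- the logarithm of `F_ss` and the integral Honda isomorphism
  have htr' : (Literature.NumberTheory.EllipticCurves.HasseManin.tr (M.map PadicInt.toZMod) : ℚ_[p]) = (a : ℚ_[p]) := by
    rw [htr]
  have hℓ : ∀ n, ‖coeff n (hondaShift p (Literature.NumberTheory.EllipticCurves.HasseManin.tr (M.map PadicInt.toZMod) : ℚ_[p])
      (PowerSeries.mk fun d ↦ ∑' k : ℕ, x k * (((p ^ k).choose d : ℚ_[p]) - if d = 0 then 1 else 0)))‖ ≤ 1 := fun n ↦ by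
    rw [htr']; exact norm_coeff_hondaShift_sprungLog_le_one ha hx0 hx1 hrec n
  obtain ⟨i, j, hi0, hj0, hij, -, hlog⟩ :=
    exists_integral_hondaIso M hp2 (constantCoeff_sprungLog x) (norm_coeff_one_sprungLog hx0 hxb) hℓ
  -- the tower points over `ℚ_p(ζ_{p^m})`
  obtain ⟨cΩ, hc0, hcL, hck, hcΛ⟩ := exists_sprungTowerPoints (M := M) hxb hi0 hlog
  -- the transported action and the dictionary
  set e := toLoc hV with he
  set act : Field.absoluteGaloisGroup ℚ_[p] → (genFibΩ p M).toAffine.Point → (genFibΩ p M).toAffine.Point :=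
    fun σ Q ↦ e.symm (σ • e Q) with hact_def
  have hact0 : ∀ σ, act σ 0 = 0 := fun σ ↦ act_zero hV σ
  have hact : ∀ σ (x y : PadicAlgCl p) (h : (genFibΩ p M).toAffine.Nonsingular x y),
      ∃ h', act σ (WeierstrassCurve.Affine.Point.some x y h) = WeierstrassCurve.Affine.Point.some (σ • x) (σ • y) h' :=
    fun σ x y h ↦ act_some hV σ x y h
  have hFix : ∀ k (P : localPoints W ℚ_[p]), P ∈ localFixedPointsOfEmb ι W (U k) ↔
      e.symm P ∈ subfieldPoints (genFibΩ p M) (layer p (k + 1)).toSubfield coeffs_mem_layer :=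
    fun k P ↦ mem_localFixedPointsOfEmb_iff_mem_subfieldPoints ι hV hU k P
  -- finiteness of the Galois quotients
  haveI hFt : ∀ m, Fintype (stab p m ⧸ (stab p (m + 1)).subgroupOf (stab p m)) := fun m ↦ by
    haveI : ((stab p (m + 1)).subgroupOf (stab p m)).FiniteIndex := by
      refine ⟨?_⟩
      rw [index_subgroupOf_stab_succ]
      split_ifs
      · have := hp.out.two_le; omega
      · exact hp.out.ne_zero
    exact Fintype.ofFinite _
  -- no `p`-power torsion in the layers
  have htorsΩ := torsionFree_layer_of_stab ι W U hp2 hΔ hA hWM hU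
  -- the error term `QΩ = −∑_{Γ/Stab(ζ_1)} q̃ ⋆ cΩ 1`, `Λ(QΩ) = p`
  set S₁ := ∑ q : stab p 0 ⧸ (stab p 1).subgroupOf (stab p 0),
    act ((q.out : stab p 0) : Field.absoluteGaloisGroup ℚ_[p]) (cΩ 1) with hS₁
  have hS₁L : S₁ ∈ subfieldPoints (genFibΩ p M) (layer p 0).toSubfield coeffs_mem_layer :=
    sum_act_one_mem_sprung hx0 act hact0 hact hcL hck hcΛ (htorsΩ 1 le_rfl)
  have hS₁k : S₁ ∈ kernel (Valued.v (R := PadicAlgCl p)) (genFibΩ p M) :=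
    (kernel _ _).sum_mem fun q _ ↦ act_mem_kernel act hact0 hact _ (hck 1)
  set QΩ := -S₁ with hQΩ
  have hQL : QΩ ∈ subfieldPoints (genFibΩ p M) (layer p 0).toSubfield coeffs_mem_layer := (subfieldPoints _ _ _).neg_mem hS₁L
  have hQk : QΩ ∈ kernel (Valued.v (R := PadicAlgCl p)) (genFibΩ p M) := (kernel _ _).neg_mem hS₁k
  have hQΛ : ptLogΩ p M QΩ = (p : PadicAlgCl p) := ptLogΩ_neg_sum_act_one_sprung act hx0 hact0 hact hcL hck hcΛ
  -- the relations over `ℚ_p(ζ_{p^m})` as equalities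
  have hrelΩ : ∀ m : ℕ, 1 ≤ m → (∑ q : stab p m ⧸ (stab p (m + 1)).subgroupOf (stab p m),
      act ((q.out : stab p m) : Field.absoluteGaloisGroup ℚ_[p]) (cΩ (m + 1))) = a • cΩ m - cΩ (m - 1) - QΩ := by
    intro m hm
    have h := sum_act_sub_smul_add_eq_sum_act_one_sprung act hx0 hx1 hrec hact0 hact hcL hck hcΛ htorsΩ hm
    rw [← hS₁] at h
    rw [hQΩ, sub_neg_eq_add, ← h]
    abel
  -- transport to `E(ℚ̄_p)`
  have hQ0 : e QΩ ∈ localLayerPointsOfEmb κ ι W 0 := by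
    rw [mem_localLayerPointsOfEmb_zero_iff]
    exact (mem_localFixedPointsOfEmb_top_iff ι W _).mp
      ((mem_localFixedPointsOfEmb_top_iff_mem_subfieldPoints ι hV _).mpr (by simpa [he] using hQL))
  have hyU : ∀ m, e (cΩ (m + 1)) ∈ localFixedPointsOfEmb ι W (U m) := fun m ↦ by
    rw [hFix, AddEquiv.symm_apply_apply]; exact hcL (m + 1)
  have hy0 : e (cΩ 0) = 0 := by rw [hc0, map_zero]
  have hrel0 : localPairTraceOfEmb ι W (κ.layerSubgroup 0) (U 0) (e (cΩ 1)) = -e QΩ := by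
    have h₁ : localSubgroupOfEmb (⊤ : Subgroup (Field.absoluteGaloisGroup ℚ)) ι = stab p 0 := by
      rw [stab_zero]; exact Subgroup.comap_top _
    rw [layerSubgroup_zero, localPairTraceOfEmb_toLoc_eq_sum ι W hV h₁ (hU 0) (hcL 1), hQΩ, map_neg, neg_neg]
  have hrel : ∀ m : ℕ, 1 ≤ m → localPairTraceOfEmb ι W (U (m - 1)) (U m) (e (cΩ (m + 1))) =
      a • e (cΩ m) - e (cΩ (m - 1)) - e QΩ := by
    intro m hm
    obtain ⟨k, rfl⟩ := Nat.exists_eq_add_of_le' hm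
    rw [Nat.add_sub_cancel, localPairTraceOfEmb_toLoc_eq_sum ι W hV (hU k) (hU (k + 1)) (hcL (k + 2)),
      show (∑ q : stab p (k + 1) ⧸ (stab p (k + 2)).subgroupOf (stab p (k + 1)),
        e.symm (((q.out : stab p (k + 1)) : Field.absoluteGaloisGroup ℚ_[p]) • e (cΩ (k + 2)))) =
        a • cΩ (k + 1) - cΩ k - QΩ by simpa using hrelΩ (k + 1) (Nat.succ_pos k),
      map_sub, map_sub, map_zsmul]
  -- `N₁ = #Ẽ(𝔽_p) = p + 1 − a`
  set N₁ : ℕ := Nat.card (M.map PadicInt.toZMod).toAffine.Point with hN₁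
  have hN₁' : (N₁ : ℤ) = p + 1 - a := by
    have h := htr
    rw [Literature.NumberTheory.EllipticCurves.HasseManin.tr, ZMod.card] at h
    rw [hN₁]
    linarith
  -- the descended points
  set c : ℕ → localPoints W ℚ_[p] := fun n ↦
    (N₁ : ℤ) • localPairTraceOfEmb ι W (κ.layerSubgroup n) (U n) (e (cΩ (n + 1))) + ((p : ℤ) - 1) • e QΩ with hc
  obtain ⟨hR0, hR1, hRn⟩ := descent_relations κ ι W U hp2 hκ hUa hUL hU hN₁' (y := fun m ↦ e (cΩ m)) hy0 hyU hQ0 hrel0 hrel c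
    (fun n ↦ rfl)
  have hcop : ((p - 1) * N₁ * N₁).Coprime p := by
    have h1 : (p - 1).Coprime p := (Nat.coprime_self_sub_left hp.out.one_lt.le).mpr (Nat.coprime_one_left p)
    have h2 : N₁.Coprime p := by
      obtain ⟨t, ht⟩ := hap
      rw [← Nat.isCoprime_iff_coprime]
      refine ⟨1, t - 1, ?_⟩
      rw [hN₁', ht]
      ring
    exact Nat.Coprime.mul_left (Nat.Coprime.mul_left h1 h2) h2
  refine ⟨e QΩ, c, (p - 1) * N₁ * N₁, hcop, hQ0, fun n ↦ descent_mem_layer κ ι W U (y := fun m ↦ e (cΩ m)) hyU hQ0 n,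
    hR0, hR1, hRn, ?_, ?_⟩
  · intro m hm P hP
    exact descent_generation κ ι W U hp2 hκ hUL hU hΔ hA hWM hV hx0 hxb hi0 hj0 hij hlog hcL hck hcΛ hQL rfl c
      (fun n ↦ rfl) hm hP
  · intro P hP
    exact descent_generation_zero κ ι W U hp2 hU hΔ hA hWM hV hQL hQk hQΛ rfl hP

end SprungHonda

end Summit.BirchSwinnertonDyer.BirchSwinnertonDyer.Theorems

end
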